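import Literature.Computability.Cryptography.AverageCaseProofs
import Literature.Computability.MetaComplexity.UHSMachine
import Literature.Computability.MetaComplexity.UniversalHeuristicSchemesHolds
import Literature.Computability.MetaComplexity.UniversalMachineProofs
import HarnessLib

/-!
# Discharge of the named fact `hirahara_UP_DistNP`

Topic `Literature/Computability/Cryptography`; proofs-only file (no definitions, no new named
facts). The named fact
`Literature.Computability.Cryptography.hirahara_UP_DistNP` (`AverageCase.lean:126`)
is closed by ONE TERM from results already in the tree: the accepted reduction
`Literature.Computability.Cryptography.hirahara_UP_DistNP_of_facts` (`AverageCaseProofs.lean:224`)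
applied to the accepted unconditional discharges `nonempty_holds`,
`Hirahara2021_hasUHS_of_mem_UP_holds`, `Hirahara2021_mem_DTIME_of_hasUHS_holds` of its hypotheses.
Found by the librarian's forward-chaining census (sweep g29, 2026-08-16): the reduction and the
last of its inputs landed in
different units, so nobody had written the closing line.
-/

namespace Literature.Computability.Cryptography

/-- **`hirahara_UP_DistNP` holds**: the reduction `hirahara_UP_DistNP_of_facts` applied to
`nonempty_holds`, `Hirahara2021_hasUHS_of_mem_UP_holds`, `Hirahara2021_mem_DTIME_of_hasUHS_holds`.
[folklore] -/
theorem hirahara_UP_DistNP_holds : hirahara_UP_DistNP :=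
  _root_.Literature.Computability.Cryptography.hirahara_UP_DistNP_of_facts
    _root_.Literature.Computability.MetaComplexity.UniversalMachine.nonempty_holds
    _root_.Literature.Computability.MetaComplexity.Hirahara2021_hasUHS_of_mem_UP_holds
    _root_.Literature.Computability.MetaComplexity.Hirahara2021_mem_DTIME_of_hasUHS_holds

end Literature.Computability.Cryptography
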